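import Mathlib
import HarnessLib
import HarnessLib.Audit
import Summits.NavierStokesRegularity.Statement
import Literature.Analysis.FluidPDE.SelfSimilar
import Literature.Analysis.FluidPDE.ClassicalSolution
import Literature.Analysis.FluidPDE.LerayHopf
import Literature.Analysis.FluidPDE.MildSolution
import Summits.NavierStokesRegularity.NavierStokesRegularity.Theorems.AdiabaticEddyClayUniqueness
import HarnessLib.Audit.Status.Attr

/-!
Route: CorkscrewDynamo

DORMANT since 2026-08-26T10:16:23Z (reconciler: no traction for 8.4 d (last activity item-evidence-added at 2026-08-18T00:53:22Z); parked, not closed — `ledger route dormant route-NavierStokesRegularity-CorkscrewDynamo --off` to reactiv) — unstaffed, not closed; items shared with open routes are served there. `ledger route dormant <id> --off` reactivates.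

It suffices to exhibit a CORKSCREW and to truncate it. Corkscrew = a nontrivial Type-I ancient mild
solution u of Navier–Stokes (ν = 1) on ℝ³×(−∞,0) that is rotated λ-discretely self-similar about a
fixed axis, λ R_θᵀ u(λ²t, λ R_θ x) = u(t,x) with λ > 1, and whose rotation is ESSENTIAL (u is not
plainly λ-DSS on the past, not even almost everywhere) — the object the card
corkscrew-dynamo-bootstrap-dss predicts: in backward similarity variables (y = x/√(−t), s =
−log(−t)) the vorticity Ω of any solution obeys the kinematic INDUCTION equation ∂ₛΩ = curl((U + ½y)
× Ω) + ΔΩ in Leray's exploding wind W = U + ½y, so a (R)DSS profile is exactly a Floquet-marginal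
dynamo maintained by its own wind; Cowling (no axisymmetric dynamo ↔ KNSS/Seregin–Šverák: no
axisymmetric Type I) and Ponomarenko (the marginal mode of a swirling jet is a non-axisymmetric
ROTATING wave) select the template, and the DYNAMO BOOTSTRAP (template wind B ↦ marginal Floquet
mode Ω_B ↦ Biot–Savart velocity ↦ new wind) has the (R)DSS profiles as its fixed points (NRS/Tsai:
provably no steady fixed point). Truncation = the conjecture-free rotated bridge
RdssProfileTruncation (any nontrivial Type-I rotated-DSS ancient mild profile ⇒ a rapidly decaying
datum with a finite-lifespan Leray–Hopf classical solution), equivalent to the wall-form bridge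
stmt-NavierStokesRegularity-0901 of route DssFarFieldSlaving and to stmt-10475 of route
EulerMelnikovDss (Iff's in the planner's SketchEquiv.lean). Rev 4 (route repair 2026-08-15): every
item is stated over Literature.Analysis.FluidPDE.SelfSimilar vocabulary + Mathlib only (rotation
about e₃ pinned by coordinates, the wall TypeIDSSLiouvilleConjecture unfolded), so the route's cone
no longer contains SelfSimilarLiouville.lean / AxisymmetricVorticityTransport.lean and their
unproved or refuted named facts.
Lean (all constants exist; Sketch.lean rc 0, deciding theorem certified): X := CorkscrewProfile ∧
RdssProfileTruncation, where
CorkscrewProfile := ∃ (c θ : ℝ) (R : ℝ³ ≃ₗᵢ[ℝ] ℝ³) (u : ℝ → ℝ³ → ℝ³), 1 < c ∧ (∀ x, R x 0 = cos θ *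
x 0 - sin θ * x 1 ∧ R x 1 = sin θ * x 0 + cos θ * x 1 ∧ R x 2 = x 2) ∧ IsAncientMildSolution 1 u ∧
(∀ t < 0, AEStronglyMeasurable (u t) volume) ∧ IsRotatedDSS c R u ∧ (∃ C₀, HasTypeIDecay C₀ u) ∧ ¬
(∀ t < 0, nsRescale c u t =ᵐ[volume] u t) ∧ ¬ (∀ t < 0, u t =ᵐ[volume] 0)
RdssProfileTruncation := (∃ (c : ℝ) (R : ℝ³ ≃ₗᵢ[ℝ] ℝ³) (u : ℝ → ℝ³ → ℝ³), 1 < c ∧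
IsAncientMildSolution 1 u ∧ (∀ t < 0, AEStronglyMeasurable (u t) volume) ∧ IsRotatedDSS c R u ∧ (∃
C₀, HasTypeIDecay C₀ u) ∧ ¬ (∀ t < 0, u t =ᵐ[volume] 0)) → ∃ ν>0, ∃ T>0, ∃ u p,
IsMaximalSmoothSolution ν 0 u p T ∧ IsLerayHopfOn T ν 0 (u 0) u ∧ HasRapidSpatialDecay (u 0).
Deciding theorem (D-0027 §2.1, rendered at the end of the route file): closes : CorkscrewProfile →
RdssProfileTruncation → ClayUniqueness (X5b, stmt-0153) → ¬NavierStokesRegularity — the corkscrew is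
a nontrivial Type-I RDSS profile, the bridge gives X5a, Clay (A) + X5b extend the blowing-up
solution past its lifespan (Literature.NS.blowup_assembly inlined; axioms
propext/Classical.choice/Quot.sound).

Rationale: WHY THIS LINE. Route Blowup files the profile half of a DSS blow-up as crux #5
(¬TypeIDSSLiouvilleConjecture, stmt-0155) with the scenario NOT decomposed; route DssFarFieldSlaving
owns the truncation half (stmt-0901) and explicitly leaves the SOURCE of the profile outside its
scope. This route is a source: the card's exact dictionary (curl-projection of the NRS/Tsai
head-pressure 'Ohm's law') makes the similarity-variable vorticity equation the MHD induction
equation with velocity W = U + ½y (Davidson2001 §5.1 p.208: the ω/B analogy, imperfect only through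
self-consistency ω = curl u — which is precisely the bootstrap's closing condition). Imported area:
kinematic dynamo theory — anti-dynamo theorems (Cowling1933; toroidal theorem BullardGellman1954;
bounds Backus1958, Nunez1997), slow-dynamo existence and template selection (Ponomarenko1973:
marginal mode of a swirling jet is m = 1, non-axisymmetric, Rm_c ≈ 35, Davidson2001 p.460;
stationary axisymmetric sphere flows with OSCILLATORY non-axisymmetric modes, DudleyJames1989;
rigorous instability GerardvaretRousset2007, Gerardvaret2005), Floquet/eigenvalue enclosure
technology for the linear step. NS side: BradshawTsai2017CPDE (RDSS class, Open Problem 5.1),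
ChaeWolf2017RemovingDSS (λ≈1 removed), Tsai2018 Conj. 8.8–8.9, KNSS2009/SereginSverak2009 (= Cowling
for profiles), NecasRuzickaSverak1996/Tsai1998 (no steady fixed point), JiaSverak2014 (forward
twin), Hou2022PotentiallySingularNS (drifting exponents read as 'no axisymmetric α-loop'). Rev 4
(route repair, 2026-08-15): the deciding theorem `closes : CorkscrewProfile → RdssProfileTruncation
→ ClayUniqueness → ¬NavierStokesRegularity` is supplied (Literature.NS.blowup_assembly inlined) and
every item is restated over SelfSimilar vocabulary + Mathlib (rotation about e₃ pinned by
coordinates; the wall unfolded into an explicit nontrivial Type-I RDSS witness), equivalences with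
the rev-3 texts proved in the planner's SketchEquiv.lean — so neither SelfSimilarLiouville.lean (7
unproved XL facts, among them the wall this route sets out to REFUTE) nor
AxisymmetricVorticityTransport/AxisymmetricEuler/Vorticity (refuted isVorticitySolutionOn_iff,
IsVorticitySolutionOn.exists_pressure) sit in the cone any more.
TWO-LAYER PLAN (D-0019). Layer 1 = three ranked cruxes + typed support; glue later.
RANKED CRUXES. #2 CorkscrewProfile [crux, NEGATIVE, the bet]: a nontrivial Type-I ancient mild
solution, rotated λ-DSS about e₃ (R pinned by coordinates to the θ-rotation) with the rotation
essential (not a.e.-plainly λ-DSS on t<0). Strictly stronger than 0155 (the 3-line corollary is the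
first step of `closes`). Why it might fail: Tsai's conjecture may hold; λ near 1 is removed under
exactly this bound (ChaeWolf2017RemovingDSS Thm 1.3, whose Def. 1.1 is stated for rotated DSS); the
bootstrap may have no marginal Floquet orbit, or only plain-DSS ones. #3 RdssProfileTruncation
[crux; conjecture-free rotated form of the shared stmt-0901, ≡ 0901 ≡ 10475]: a nontrivial Type-I
rotated-DSS ancient mild profile (any λ>1, any R ∈ O(3)) truncates to a rapidly decaying datum whose
Leray–Hopf classical solution has finite maximal lifespan (X5a). Why it might fail: no hyperbolicity
of the (R)DSS orbit (see DssFarFieldSlaving #2); only the local transfer AlbrittonBarker2019 Thm 1.1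
is known. #4 KinematicCorkscrewMode [crux, LINEAR seed + template claim, computable]: some smooth
steady AXISYMMETRIC divergence-free template wind B with Type-I envelope (1+|y|)|B| + (1+|y|)²|∇B| ≤
C carries a smooth divergence-free solution Ω of ∂ₛΩ = curl((B+½y)×Ω) + ΔΩ on ℝ×ℝ³ with Ω(s+L,y) =
e^{μL} R_θ Ω(s, R_{−θ}y), μ ≥ 0, (1+|y|)²|Ω| ≤ Ke^{μs}, and R_θ NOT a symmetry of Ω(0,·) (a
genuinely rotating, hence non-axisymmetric, marginal/growing mode: Ponomarenko in Leray's wind;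
rotations R_φ entered as a coordinate-pinned family). Why it might fail: the wind charges a dilution
tax (−1 in L²(e^{−|y|²/4}), −¼ in L²) plus outward transport; no rigorous steady smooth whole-space
dynamo exists in print even without the wind; realistic proof = perturbation at large C from a
certified (interval) m = 1 eigenvalue enclosure of the (r,z)-reduced operator (kit compute), or a
Gérard-Varet–Rousset-type construction.
SUPPORT (rank 9, typed, closeable): WindDynamoExists (bare seed: the kinematic Liouville problem in
the wind FAILS for some Type-I template — eternal solution of at most exponential growth in the
(1+|y|)⁻² class; implied by #4); NoSmallConstantWindDynamo (positive rung with explicit constant: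
sup|y||B| ≤ a, sup‖∇B‖ ≤ b, b + a/4 < 1 ⇒ no such solution; proof = L²(γ) energy identity, γ =
e^{−|y|²/4}: ½d/ds‖Ω‖²_γ = −‖∇Ω‖²_γ − ‖Ω‖²_γ + ∫⟨(Ω·∇)B,Ω⟩γ + ¼∫|Ω|²(B·y)γ); SphereTangentLiouville
(Bullard–Gellman toroidal theorem transplanted: a Type-I RDSS ancient mild solution with x·u ≡ 0
vanishes, via the exact identity (∂ₛ + W·∇ − Δ + ½)(y·Ω) = Ω·∇(y·U), maximum principle, and Hodge on
S²); ClassicalCorkscrewSuffices (landing pad: a classical RDSS Type-I solution on (−∞,0) with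
pressure bounded on past slabs and essential rotation IS a CorkscrewProfile witness — Literature
IsClassicalNSSolutionOn.isMildNSSolutionOn_holds); shared ClayUniqueness (X5b, stmt-0153); Target
Thesis = #2 ∧ #3; Assembly by name (= the type of `closes`). Dropped at rev 4 as not load-bearing:
TypeIDssProfileExists (0155, still wanted by Blowup/DssFarFieldSlaving) and CorkscrewImpliesProfile
— their content is the first line of `closes`, and naming the wall imported its unprovable module
into the cone.
KILL CRITERIA. TypeIDSSLiouvilleConjecture proved (0155 refuted; equivalently the antecedent of
RdssProfileTruncation shown empty) ⇒ close refuted:CorkscrewProfile. A theorem 'RDSS Type-I ⇒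
plainly DSS' (rotation never essential) refutes #2 while 0155 may survive ⇒ close, census to
Blowup/DssFarFieldSlaving. ¬WindDynamoExists (kinematic Liouville in the wind for ALL Type-I
templates) kills the mechanism outright — and would be a new positive-side tool worth its own route.
NoSmallConstantWindDynamo's threshold rising to cover the constants of any certified candidate
retires that candidate. NoBlowup (stmt-0054) ⇒ moot.
NOT DECOMPOSED YET. The nonlinear closing step (continuation of the kinematic mode along the
Biot–Savart feedback; equivariant Floquet classes; interval enclosure of the monodromy spectrum),
the ¼/½ period-mean budgets and the eigenvalue pre-test on Hou's data (rungs for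
type-i-certificate-ladder), Cowling-in-the-wind for the kinematic problem (flux function does not
decay at infinity: Harnack-from-infinity as in KNSS Thm 5.3) — layer-2 material once #4 closes or a
candidate exists. X5b is attacked in route Blowup; the truncation bridge is decomposed in route
DssFarFieldSlaving (hyperbolic stable-manifold version).
CHEAPEST FALSIFIER. Run the LINEAR problem first: for the Ponomarenko/Dudley–James template winds
rescaled into the Type-I envelope, compute the leading m = 1 Floquet exponent of ∂ₛ − curl((B+½y)×·)
− Δ on the (r,z)-reduced grid (kit compute, then interval enclosure); if for every admissible C the
real part stays below the dilution tax (no marginal rotating mode: ¬KinematicCorkscrewMode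
numerically, NoSmallConstantWindDynamo-type bound analytically), the bootstrap has nothing to
continue and the line is dead before any nonlinear work.
NUMBERS. Dilution: curl(½y×Ω) = −Ω − ½y·∇Ω; OU spectrum of Δ − ½y·∇ − 1 on L²(γ): {−1 − k/2}; L²
numerical-range shift +¾ ⇒ net tax ¼ (Leray's ‖∇u‖₂ ≳ (T−t)^{-1/4}); marginal modes decay like
|y|^{-2-2μ}; Ponomarenko Rm_c ≈ 35 (Davidson2001 p.460); small-constant rung b + a/4 < 1. Items at
rev 4: 10 (3 cruxes, 5 support incl. 1 shared, target, assembly) + the deciding theorem.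

Novelty: NOVELTY (searched 2026-08-15 by this planner: `lit search --source crossref` ×4 — "dynamo analogy
vorticity stretching self-similar blow-up Navier–Stokes Cowling antidynamo" (15 rows, none joining
dynamo theory to Leray profiles), "rotationally corrected scaling invariant discretely self-similar"
(Bradshaw–Tsai corpus: BradshawTsai2017CPDE/Rotational, BradshawTsai2019, Tsai2014,
ChaeWolf2017RemovingDSS, Bradshaw–Phelps 2023 — all forward existence / backward removal, no RDSS
construction attempt), "kinematic dynamo rigorous proof Ponomarenko spherical axisymmetric"
(Nunez1997 rigorous bounds; Dudley–James numerics), "Gérard-Varet Rousset … dynamo"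
(GerardvaretRousset2007, Gerardvaret2005); `lit vsearch` of the dictionary sentence (10 docs:
Davidson2001 pp.208–213 ω/B analogy, Majda–Bertozzi — analogy folklore, no similarity-variable use);
`lit frontier NavierStokesRegularity --since 2022` (30 rows: forward self-similar
2-D/hypodissipative arXiv:2601.03161, 2603.12497, 2601.03833; Hou's generalised axisymmetric blow-up
doi:10.1007/s10208-026-09748-8; sharp non-uniqueness — nothing backward-RDSS, nothing dynamo); `lit
bridges --cross any` (no MHD/dynamo bridge papers); held-text reads Davidson2001 pp.458–468 (Cowling
§14.5.4 eqs 14.27–28; Ponomarenko Rm > 35, non-axisymmetric field from axisymmetric flow p.460);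
searchd/galaxy were saturated (rc 75 / queue > 90 s) during the session — the card's own audit
(refuter-novelty-audit-5, 2026-08-15: crossref/zbMATH sweeps, Davidson §1  [refs: 10.1007/s10208-026-09748-8, 2601.03161, doi:10.1007/s10208-026-09748-8, BradshawTsai2019, Tsai2014, Nunez1997, GerardvaretRousset2007, Gerardvaret2005, Davidson2001, Tsai2018, Ponomarenko1973, DudleyJames1989, Backus1958, Cowling1933, BullardGellman1954]

Barriers (technique_class: kinematic-dynamo floquet-bootstrap rdss-profile-construction): BARRIERS (catalogue Literature/Barriers/NavierStokesRegularity read 2026-08-15; technique_class: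
kinematic-dynamo floquet-bootstrap rdss-profile-construction).
- Literature.Barriers.NavierStokesRegularity.LeraySelfSimilarBlowupExclusion (necas_ruzicka_sverak,
tsai_selfsimilar, tsai_selfsimilar_local_energy): applies to λ-CONTINUOUS profiles (steady fixed
points of the bootstrap; Type-I tails are L^q, q > 3, so Tsai1998 Thm 1 kills them) — RESPECTED AND
USED: the bootstrap is run only in the s-periodic / rotating-wave (Floquet) class, λ > 1 away from
the Chae–Wolf window (ChaeWolf2017RemovingDSS Thm 1.3 constrains CorkscrewProfile's λ for each C₀);
'no steady fixed point' is a free correctness certificate for any implementation.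
- Literature.Barriers.NavierStokesRegularity.AxisymmetricTypeIExclusion (SereginSverak2009 Thm 3.1;
in-tree knss_no_axisymmetric_typeI, knss_bound_C_over_r): applies to any axisymmetric profile —
EVADED BY DESIGN and EXPLAINED: it is Cowling's theorem for the self-consistent dynamo;
CorkscrewProfile's witness is automatically non-axisymmetric (an axisymmetric Type-I RDSS field is
plainly DSS and |u| ≤ C/r-bounded, hence zero), and KinematicCorkscrewMode asks for a mode on which
R_θ acts nontrivially. The template WIND may be axisymmetric (Ponomarenko): the barrier constrains
the field, not the flow that seeds it.
- Literature.Barriers.NavierStokesRegularity.CriticalNormBlowupNecessity (ess_endpoint,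
seregin_L3_blowup, tao_L3_blowup_rate): respected — a

Novelty grade: new-combination — ROUTE REVIEW (refuter, 2026-08-15). All 12 decls elaborate (Probe1 rc0). Defs read back and faithful: IsRotatedDSS ∀ t x (junk t ≥ 0 harmless: witness 0 there), HasTypeIDecay/ancient-mild on t<0, IsAxisymmetric = R_θ-equivariance, timeDerivWithin univ = ∂ₛ; wind-induction sign conventions verified ( (refuter refuter-rreview-route-NavierStokesRegula-42467265-0, 2026-08-15T12:18:46Z; prior: BradshawTsai2017CPDE §5 OP 5.1 / arXiv:1802.00038 p.3 (backward RDSS under Type I bound open; backward DSS open for λ ≫ 1), ChaeWolf2017RemovingDSS Thm 1.3 (λ near 1 removed), KNSS2009 / SereginSverak2009 (axisymmetric Type I = Cowling side), Davidson2001 §14.5 / Ponomarenko1973 / GerardvaretRousset2007 (kinematic dynamo template), Tsai1998 / NecasRuzickaSverak1996 (no steady fixed point), card co)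

History (route lifecycle, newest last):
- 2026-08-15T10:58:11Z · rev 2: restated KinematicCorkscrewMode (stmt-NavierStokesRegularity-1362), WindDynamoExists (stmt-NavierStokesRegularity-1363), NoSmallConstantWindDynamo (stmt-NavierStokesRegularity-1364) — materialise the three kinematic items (stmt-1362/1363/1364 were BLOCKED at open: the scoped notation Δ is not opened in route fil (planner-plancard-NavierStokesRegularity-Navie-4e29d614-0)
- 2026-08-15T16:59:33Z · rev 4: restated CorkscrewProfile (stmt-NavierStokesRegularity-1361), KinematicCorkscrewMode (stmt-NavierStokesRegularity-1713), Thesis (stmt-NavierStokesRegularity-1359), ClassicalCorkscrewSuffices (stmt-NavierStokesRegularity-1366), Assembly (stmt-NavierStokesRegularity-1360), WindDynamoExists (stmt-NavierStokesRegula (planner-rbadge-NavierStokesRegularity-Corkscre-c6e82750-g2-0)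
- 2026-08-15T16:59:33Z · rev 4: dropped CorkscrewImpliesProfile — route-repair (glue + cone): closes : CorkscrewProfile → RdssProfileTruncation → ClayUniqueness → ¬NavierStokesRegularity (planner's Sketch.lean: lean rc 0, audi (planner-rbadge-NavierStokesRegularity-Corkscre-c6e82750-g2-0)
- 2026-08-16T02:17:28Z · AUTO-CRUX: 1 conjecture-grade item(s) promoted to crux (Thesis) — refuter vetting / tiering apply (operator:999:1362873)
- 2026-08-26T10:16:23Z · DORMANT — reconciler: no traction for 8.4 d (last activity item-evidence-added at 2026-08-18T00:53:22Z); parked, not closed — `ledger route dormant route-NavierStokesRegu (operator:999:3960335)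

sub-problem: NavierStokesRegularity · status: dormant · opened planner-plancard-NavierStokesRegularity-Navie-4e29d614-0 2026-08-15T10:55:04Z · rev 4 · ledger route-NavierStokesRegularity-CorkscrewDynamo
GENERATED by the gate from the ledger (D-0016/17). Provers cite these decls: `theorem foo : Summit.NavierStokesRegularity.NavierStokesRegularity.Theses.CorkscrewDynamo.<Decl> := …` in Summits/NavierStokesRegularity/NavierStokesRegularity/Theorems/<Name>.lean.
-/

namespace Summit.NavierStokesRegularity.NavierStokesRegularity.Theses.CorkscrewDynamo

open scoped BigOperators Topology Manifold Classical MeasureTheory ProbabilityTheory Matrix InnerProductSpace ComplexConjugate ContinuousMap ContDiff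
open Filter Set Function TopologicalSpace MeasureTheory

attribute [summit_statement] _root_.NavierStokesRegularity

open Literature.NS

-- earlier Thesis (stmt-NavierStokesRegularity-1359, replaced 2026-08-15T16:59:33Z -> stmt-NavierStokesRegularity-11284): retired by None — (∃ (c θ : ℝ) (u : ℝ → EuclideanSpace ℝ (Fin 3) → EuclideanSpace ℝ (Fin 3)), 1 < c ∧ Literature.Analysis.FluidPDE.IsAncientMildSolution 1 u ∧ (∀ t < 0, AEStronglyMeasurable (u t) volume) ∧ Literature.Analysis.FluidPDE.IsRotatedDSS c (Literature.Analysis.FluidPDE.r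
/-- item stmt-NavierStokesRegularity-11284 · target · rank 0 · open · by planner
why it might fail: Either half can fail: Tsai's Type-I (R)DSS Liouville conjecture may be true (λ≈1 removed: ChaeWolf2017RemovingDSS Thm 1.3; SS: Tsai1998; axisymmetric: KNSS2009) or rotation is never essential; unconditional truncation may need hyperbolicity (only a local transfer is known, AlbrittonBarker2019).
sources: BradshawTsai2017CPDE, arXiv:1802.00038, Tsai2018, ChaeWolf2017RemovingDSS, AlbrittonBarker2019, Davidson2001
[target] X = CorkscrewProfile ∧ RdssProfileTruncation (card corkscrew-dynamo-bootstrap-dss):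
literally the conjunction of crux #2 and crux #3 (Iff.rfl in the planner's Sketch.lean).
CorkscrewProfile: for some λ>1 and angle θ there is a nontrivial ancient mild solution u of NS (ν=1)
on ℝ³×(−∞,0) with measurable slices, rotated λ-DSS about the x₃-axis (λR_θᵀu(λ²t,λR_θx) = u(t,x),
R_θ pinned by coordinates), Type-I bounded |u| ≤ C₀/(|x|+√−t), whose rotation is ESSENTIAL: u is not
a.e.-plainly λ-DSS on t<0. RdssProfileTruncation: every nontrivial Type-I rotated-DSS ancient mild
profile truncates to a rapidly decaying datum with a finite-lifespan Leray–Hopf classical solution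
(X5a). X → ¬NavierStokesRegularity through ClayUniqueness (X5b, stmt-0153) is the deciding theorem
`closes` (D-0027 §2.1). Dynamo reading (exact, card §Mechanism): in y = x/√(−t), s = −log(−t) the
vorticity obeys ∂ₛΩ = curl((U+½y)×Ω) + ΔΩ, so a corkscrew is a Floquet-marginal kinematic dynamo in
Leray's exploding wind, closed by Ω = curl U; Cowling ⇒ not axisymmetric, Ponomarenko ⇒ rotating m=1
pattern. [rev 4, route repair 2026-08-15: both halves conjecture-free and Mathlib-pinned;
equivalences with the rev-3 text -/
@[route_item "route-NavierStokesRegularity-CorkscrewDynamo"]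
def Thesis : Prop :=
  (∃ (c θ : ℝ) (R : EuclideanSpace ℝ (Fin 3) ≃ₗᵢ[ℝ] EuclideanSpace ℝ (Fin 3)) (u : ℝ → EuclideanSpace ℝ (Fin 3) → EuclideanSpace ℝ (Fin 3)), 1 < c ∧ (∀ x : EuclideanSpace ℝ (Fin 3), R x 0 = Real.cos θ * x 0 - Real.sin θ * x 1 ∧ R x 1 = Real.sin θ * x 0 + Real.cos θ * x 1 ∧ R x 2 = x 2) ∧ Literature.Analysis.FluidPDE.IsAncientMildSolution 1 u ∧ (∀ t < 0, AEStronglyMeasurable (u t) volume) ∧ Literature.Analysis.FluidPDE.IsRotatedDSS c R u ∧ (∃ C₀ : ℝ, Literature.Analysis.FluidPDE.HasTypeIDecay C₀ u) ∧ ¬ (∀ t < 0, Literature.Analysis.FluidPDE.nsRescale c u t =ᵐ[volume] u t) ∧ ¬ (∀ t < 0, u t =ᵐ[volume] 0)) ∧ ((∃ (c : ℝ) (R : EuclideanSpace ℝ (Fin 3) ≃ₗᵢ[ℝ] EuclideanSpace ℝ (Fin 3)) (u : ℝ → EuclideanSpace ℝ (Fin 3) → EuclideanSpace ℝ (Fin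 3)), 1 < c ∧ Literature.Analysis.FluidPDE.IsAncientMildSolution 1 u ∧ (∀ t < 0, AEStronglyMeasurable (u t) volume) ∧ Literature.Analysis.FluidPDE.IsRotatedDSS c R u ∧ (∃ C₀ : ℝ, Literature.Analysis.FluidPDE.HasTypeIDecay C₀ u) ∧ ¬ (∀ t < 0, u t =ᵐ[volume] 0)) → ∃ ν : ℝ, 0 < ν ∧ ∃ T : ℝ, 0 < T ∧ ∃ (u : ℝ → EuclideanSpace ℝ (Fin 3) → EuclideanSpace ℝ (Fin 3)) (p : ℝ → EuclideanSpace ℝ (Fin 3) → ℝ), Literature.Analysis.FluidPDE.IsMaximalSmoothSolution ν 0 u p T ∧ Literature.Analysis.FluidPDE.IsLerayHopfOn T ν 0 (u 0) u ∧ Literature.Analysis.FluidPDE.HasRapidSpatialDecay (u 0))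

-- earlier CorkscrewProfile (stmt-NavierStokesRegularity-1361, replaced 2026-08-15T16:59:33Z -> stmt-NavierStokesRegularity-11282): retired by None — ∃ (c θ : ℝ) (u : ℝ → EuclideanSpace ℝ (Fin 3) → EuclideanSpace ℝ (Fin 3)), 1 < c ∧ Literature.Analysis.FluidPDE.IsAncientMildSolution 1 u ∧ (∀ t < 0, AEStronglyMeasurable (u t) volume) ∧ Literature.Analysis.FluidPDE.IsRotatedDSS c (Literature.Analysis.F
/-- item stmt-NavierStokesRegularity-11282 · crux · rank 2 · open · by planner
why it might fail: Tsai's Type-I DSS Liouville conjecture may hold: λ∈(1,λ₀(C₀)) is already removed under this very bound (ChaeWolf2017RemovingDSS Thm 1.3, Def 1.1 covers RDSS), axisymmetric profiles by KNSS2009; and every Type-I RDSS profile might be a.e. plainly DSS (rotation never essential).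
sources: BradshawTsai2017CPDE, arXiv:1802.00038, ChaeWolf2017RemovingDSS, Tsai2018, KNSS2009
[crux] THE BET (negative side): a CORKSCREW exists — ∃ λ>1, θ, u: ancient mild (ν=1) on ℝ³×(−∞,0),
measurable slices, rotated λ-DSS about the x₃-axis (λR_θᵀu(λ²t,λR_θx) = u(t,x); R_θ is the bound
isometry R PINNED BY COORDINATES (Rx)₀ = cos θ·x₀ − sin θ·x₁, (Rx)₁ = sin θ·x₀ + cos θ·x₁, (Rx)₂ =
x₂, i.e. R = rotZLIE θ), Type-I |u| ≤ C₀/(|x|+√−t), NOT a.e.-plainly λ-DSS on t<0 (rotation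
ESSENTIAL ⇒ cos θ ≠ 1, non-axisymmetric; robust to junk slices t ≥ 0 and null-set edits), nontrivial
on t<0. Strictly stronger than ¬TypeIDSSLiouvilleConjecture (stmt-0155 of Blowup/DssFarFieldSlaving;
the 3-line corollary is the first step of the deciding theorem `closes`). Intended construction =
the card's DYNAMO BOOTSTRAP in backward similarity variables y = x/√(−t), s = −log(−t): template
wind B ↦ marginal Floquet mode Ω_B of ∂ₛ − curl((B+½y)×·) − Δ (growth tuned to 0 by scaling B) ↦ U_B
:= Biot–Savart(Ω_B) ↦ new wind; fixed points are exactly (R)DSS profiles; NRS/Tsai certify that no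
STEADY fixed point exists (free correctness check of any code); run in the rotating-wave class
seeded by KinematicCorkscrewMode, with interval enclosure of the monodromy spectrum for a certified
candidate, then conti -/
@[route_item "route-NavierStokesRegularity-CorkscrewDynamo", crux]
def CorkscrewProfile : Prop :=
  ∃ (c θ : ℝ) (R : EuclideanSpace ℝ (Fin 3) ≃ₗᵢ[ℝ] EuclideanSpace ℝ (Fin 3)) (u : ℝ → EuclideanSpace ℝ (Fin 3) → EuclideanSpace ℝ (Fin 3)), 1 < c ∧ (∀ x : EuclideanSpace ℝ (Fin 3), R x 0 = Real.cos θ * x 0 - Real.sin θ * x 1 ∧ R x 1 = Real.sin θ * x 0 + Real.cos θ * x 1 ∧ R x 2 = x 2) ∧ Literature.Analysis.FluidPDE.IsAncientMildSolution 1 u ∧ (∀ t < 0, AEStronglyMeasurable (u t) volume) ∧ Literature.Analysis.FluidPDE.IsRotatedDSS c R u ∧ (∃ C₀ : ℝ, Literature.Analysis.FluidPDE.HasTypeIDecay C₀ u) ∧ ¬ (∀ t < 0, Literature.Analysis.FluidPDE.nsRescale c u t =ᵐ[volume] u t) ∧ ¬ (∀ t < 0, u t =ᵐ[volume] 0)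

/-- item stmt-NavierStokesRegularity-11289 · crux · rank 3 · closed · proved by Summit.NavierStokesRegularity.NavierStokesRegularity.Theorems.filamentSkeletonRss_rdssProfileTruncation_proof @ 116787d12f51 (prover) · by planner
why it might fail: Only the LOCAL transfer is known (AlbrittonBarker2019 Thm 1.1: Type-I ancient solution ⇒ suitable weak solution singular in a cylinder); Schwartz data need stability of the (R)DSS orbit, whose monodromy may carry neutral/unstable multipliers — then only a hyperbolic bridge holds.
sources: AlbrittonBarker2019, arXiv:1811.00502, JiaSverak2014, BradshawTsai2017CPDE, Tsai2018
[crux] TRUNCATION BRIDGE, CONJECTURE-FREE ROTATED FORM — the route-repair replacement, in THIS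
route, of the shared wall-form bridge stmt-0901 (DssTruncationBridge: ¬TypeIDSSLiouvilleConjecture →
X5a). If for some factor λ>1 and some linear isometry R ∈ O(3) there is a NONTRIVIAL ancient mild
solution u (ν=1, measurable slices) on ℝ³×(−∞,0), rotated λ-DSS (λRᵀu(λ²t,λRx) = u(t,x)), Type-I
bounded |u| ≤ C₀/(|x|+√−t), then some rapidly decaying divergence-free datum has a Leray–Hopf
classical solution of FINITE maximal lifespan (IsMaximalSmoothSolution ∧ IsLerayHopfOn ∧
HasRapidSpatialDecay (u 0) = X5a of Literature.NS.blowup_assembly; any ν>0 by scaling). EQUIVALENT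
to stmt-0901 and to stmt-10475 (RotatedDssBlowupBridge, route EulerMelnikovDss) through the accepted
typeIDSSLiouvilleConjecture_iff — both Iff's proved in the planner's SketchEquiv.lean (lean rc 0),
so a proof of any one of the three closes the other two in three lines; PROVERS: file all three.
Stated over the SelfSimilar/ClassicalSolution/LerayHopf vocabulary only, so
SelfSimilarLiouville.lean (7 unproved XL facts, among them the wall this route sets out to refute)
leaves the cone. Construction as in 0901: similarity va -/
@[route_item "route-NavierStokesRegularity-CorkscrewDynamo", crux]
def RdssProfileTruncation : Prop :=
  (∃ (c : ℝ) (R : EuclideanSpace ℝ (Fin 3) ≃ₗᵢ[ℝ] EuclideanSpace ℝ (Fin 3)) (u : ℝ → EuclideanSpace ℝ (Fin 3) → EuclideanSpace ℝ (Fin 3)), 1 < c ∧ Literature.Analysis.FluidPDE.IsAncientMildSolution 1 u ∧ (∀ t < 0, AEStronglyMeasurable (u t) volume) ∧ Literature.Analysis.FluidPDE.IsRotatedDSS c R u ∧ (∃ C₀ : ℝ, Literature.Analysis.FluidPDE.HasTypeIDecay C₀ u) ∧ ¬ (∀ t < 0, u t =ᵐ[volume] 0)) → ∃ ν : ℝ,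 0 < ν ∧ ∃ T : ℝ, 0 < T ∧ ∃ (u : ℝ → EuclideanSpace ℝ (Fin 3) → EuclideanSpace ℝ (Fin 3)) (p : ℝ → EuclideanSpace ℝ (Fin 3) → ℝ), Literature.Analysis.FluidPDE.IsMaximalSmoothSolution ν 0 u p T ∧ Literature.Analysis.FluidPDE.IsLerayHopfOn T ν 0 (u 0) u ∧ Literature.Analysis.FluidPDE.HasRapidSpatialDecay (u 0)

-- `RdssProfileTruncation` holds: proved by `Summit.NavierStokesRegularity.NavierStokesRegularity.Theorems.filamentSkeletonRss_rdssProfileTruncation_proof` @ 116787d12f51 (its module imports this route file, so no `_holds` link can be stated here).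

-- earlier KinematicCorkscrewMode (stmt-NavierStokesRegularity-1362, replaced 2026-08-15T10:58:11Z -> stmt-NavierStokesRegularity-1713): retired by None — ∃ (C : ℝ) (B : EuclideanSpace ℝ (Fin 3) → EuclideanSpace ℝ (Fin 3)), ContDiff ℝ ∞ B ∧ Literature.Analysis.FluidPDE.VectorCalculus.IsDivFree B ∧ Literature.Analysis.FluidPDE.IsAxisymmetric B ∧ (∀ y, (1 + ‖y‖) * ‖B y‖ + (1 + ‖y‖) ^ 2 * ‖fderiv ℝ B y‖
-- earlier KinematicCorkscrewMode (stmt-NavierStokesRegularity-1713, replaced 2026-08-15T16:59:33Z -> stmt-NavierStokesRegularity-11283): retired by None — ∃ (C : ℝ) (B : EuclideanSpace ℝ (Fin 3) → EuclideanSpace ℝ (Fin 3)), ContDiff ℝ ∞ B ∧ Literature.Analysis.FluidPDE.VectorCalculus.IsDivFree B ∧ Literature.Analysis.FluidPDE.IsAxisymmetric B ∧ (∀ y, (1 + ‖y‖) * ‖B y‖ + (1 + ‖y‖) ^ 2 * ‖fderiv ℝ B y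
/-- item stmt-NavierStokesRegularity-11283 · crux · rank 4 · open · by planner
why it might fail: Leray's wind taxes every mode (−1 on L²(e^{−|y|²/4}), −¼ on L²; linear flows alone are anti-dynamos, ZRMS 1984) while the Type-I envelope caps Rm ≲ C; no rigorous smooth steady dynamo with a decaying 3-D field is in print even without the wind; the m≠0 mode must oscillate.
sources: Ponomarenko1973, GerardvaretRousset2007, DudleyJames1989, doi:10.1017/s0022112084001488, Davidson2001, Backus1958
[crux, LINEAR seed + template claim; decidable by certified computation] PONOMARENKO IN LERAY'S
WIND: there is a smooth, steady, divergence-free, AXISYMMETRIC template wind B on ℝ³ (∀ φ y, B(R_φ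
y) = R_φ B(y), the rotations R_φ about e₃ entering as a bound family Rot : ℝ → O(3) PINNED BY
COORDINATES, forced to equal rotZLIE) inside a Type-I envelope ((1+|y|)|B| + (1+|y|)²‖∇B‖ ≤ C, C as
large as needed) and a smooth divergence-free solution Ω of the wind-induction equation ∂ₛΩ =
curl((B + ½y) × Ω) + ΔΩ on all of ℝ×ℝ³ which is a ROTATING-WAVE FLOQUET MODE: Ω(s+L, y) = e^{μL} R_θ
Ω(s, R_{−θ} y) with L>0, μ ≥ 0 (marginal or growing), in the growth class (1+|y|)²|Ω(s,y)| ≤ K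
e^{μs} for all s (for a Floquet mode = (1+|y|)²|Ω| bounded on one period; marginal modes decay like
|y|^{−2−2μ}), and R_θ NOT a symmetry of Ω(0,·) (the pattern genuinely turns ⇒ non-axisymmetric, m ≠
0, complex growth rate). Dictionary check: curl(½y×Ω) = −Ω − ½y·∇Ω (dilution + outward transport);
for an axisymmetric steady B modes separate as e^{imφ}e^{(σ+iω)s} and ω ≠ 0 ≠ m gives the covariance
with θ = −ωL/m for every L. Template: a compact swirling jet / sphere-filling roll+shear flow whose
core speed beats ½|y| -/
@[route_item "route-NavierStokesRegularity-CorkscrewDynamo", crux]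
def KinematicCorkscrewMode : Prop :=
  ∃ (C : ℝ) (B : EuclideanSpace ℝ (Fin 3) → EuclideanSpace ℝ (Fin 3)) (Rot : ℝ → (EuclideanSpace ℝ (Fin 3) ≃ₗᵢ[ℝ] EuclideanSpace ℝ (Fin 3))), (∀ (φ : ℝ) (x : EuclideanSpace ℝ (Fin 3)), Rot φ x 0 = Real.cos φ * x 0 - Real.sin φ * x 1 ∧ Rot φ x 1 = Real.sin φ * x 0 + Real.cos φ * x 1 ∧ Rot φ x 2 = x 2) ∧ ContDiff ℝ (⊤ : ℕ∞) B ∧ Literature.Analysis.FluidPDE.VectorCalculus.IsDivFree B ∧ (∀ φ y, B (Rot φ y) = Rot φ (B y)) ∧ (∀ y, (1 + ‖y‖) * ‖B y‖ + (1 + ‖y‖) ^ 2 * ‖fderiv ℝ B y‖ ≤ C) ∧ ∃ (Ω : ℝ → EuclideanSpace ℝ (Fin 3) → EuclideanSpace ℝ (Fin 3)) (L θ μ K : ℝ), 0 < L ∧ 0 ≤ μ ∧ Literature.Analysis.FluidPDE.IsSmoothSpaceTimeOn Set.univ Ω ∧ (∀ s, Literature.Analysis.FluidPDE.VectorCalculus.IsDivFree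 (Ω s)) ∧ (∀ s y, Literature.Analysis.FluidPDE.timeDerivWithin Set.univ Ω s y = Literature.Analysis.FluidPDE.curl (fun z => Literature.Analysis.FluidPDE.cross (B z + (1 / 2 : ℝ) • z) (Ω s z)) y + Laplacian.laplacian (Ω s) y) ∧ (∀ s y, Ω (s + L) y = Real.exp (μ * L) • Rot θ (Ω s (Rot (-θ) y))) ∧ (∀ s y, (1 + ‖y‖) ^ 2 * ‖Ω s y‖ ≤ K * Real.exp (μ * s)) ∧ (∃ y, Rot θ (Ω 0 (Rot (-θ) y)) ≠ Ω 0 y)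

/-- item stmt-NavierStokesRegularity-0153 · support · rank 9 · closed · proved by Summit.NavierStokesRegularity.NavierStokesRegularity.Theorems.adiabaticEddy_clayUniqueness_proof @ 47141fc88209 (prover) · by planner
Fefferman's class (A) = jointly C^∞ on ℝ³×[0,∞) + sup_t ∫|u|² < ∞; no energy inequality, no decay of
∇u, no integrability in LPS scales is assumed. Claim: such (u,p) coincides on [0,T) with any
Leray–Hopf classical solution v from the same rapidly decaying datum. Expected route: smoothness +
bounded energy ⇒ u is a distributional solution with locally finite dissipation?? (NOT automatic:
∫∫|∇u|² may be infinite) — this is exactly the delicate point; alternatives: Liouville-type control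
of the pressure (p harmonic part must be affine ⇒ excluded by bounded energy), then local energy
inequality, then weak–strong uniqueness (Prodi 1959, Serrin 1963) against v which is in every LPS
class on compacts of [0,T). [sources: Prodi1959, Serrin1963, Fefferman2000, LemarieRieusset2002,
RobinsonRodrigoSadowski2016] -/
@[route_item "route-NavierStokesRegularity-CorkscrewDynamo", crux]
def ClayUniqueness : Prop :=
  ∀ ν : ℝ, 0 < ν → ∀ (u₀ : EuclideanSpace ℝ (Fin 3) → EuclideanSpace ℝ (Fin 3)), Literature.Analysis.FluidPDE.HasRapidSpatialDecay u₀ → ∀ (u v : ℝ → EuclideanSpace ℝ (Fin 3) → EuclideanSpace ℝ (Fin 3)) (p q : ℝ → EuclideanSpace ℝ (Fin 3) → ℝ) (T : ℝ), 0 < T → Literature.Analysis.FluidPDE.IsSmoothOnHalfSpace u → Literature.Analysis.FluidPDE.IsSmoothOnHalfSpace p → Literature.Analysis.FluidPDE.IsNavierStokesSolution ν 0 u₀ u p → Literature.Analysis.FluidPDE.HasBoundedEnergy u → Literature.Analysis.FluidPDE.IsClassicalNSSolutionOn (Set.Ico 0 T) ν 0 v q → Literature.Analysis.FluidPDE.IsLerayHopfOn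 T ν 0 u₀ v → v 0 = u₀ → ∀ t ∈ Set.Ico 0 T, u t = v t

/-- `ClayUniqueness` holds: proved by `Summit.NavierStokesRegularity.NavierStokesRegularity.Theorems.adiabaticEddy_clayUniqueness_proof` @ 47141fc88209. -/
theorem ClayUniqueness_holds : ClayUniqueness := _root_.Summit.NavierStokesRegularity.NavierStokesRegularity.Theorems.adiabaticEddy_clayUniqueness_proof

-- earlier ClassicalCorkscrewSuffices (stmt-NavierStokesRegularity-1366, replaced 2026-08-15T16:59:33Z -> stmt-NavierStokesRegularity-11285): retired by None — (∃ (c θ C₀ : ℝ) (u : ℝ → EuclideanSpace ℝ (Fin 3) → EuclideanSpace ℝ (Fin 3)) (p : ℝ → EuclideanSpace ℝ (Fin 3) → ℝ), 1 < c ∧ Literature.Analysis.FluidPDE.IsClassicalNSSolutionOn (Set.Iio 0) 1 0 u p ∧ Literature.Analysis.FluidPDE.IsRotatedDSS 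
/-- item stmt-NavierStokesRegularity-11285 · support · rank 9 · closed · proved by Summit.NavierStokesRegularity.NavierStokesRegularity.Theorems.classicalCorkscrewSuffices_proof @ 1dd295dec660 (prover) · by planner
[support, landing pad; provable now] What a constructor must deliver: if (u,p) is a CLASSICAL
Navier–Stokes solution (ν=1, f=0) on the time set (−∞,0) (IsClassicalNSSolutionOn (Set.Iio 0) 1 0 u
p), rotated λ-DSS about e₃ (IsRotatedDSS c R u, R the θ-rotation, λ = c > 1), Type-I (HasTypeIDecay
C₀ u), with pressure bounded on every past slab (−∞,t], t<0 (true for profiles: p ~ C₀²/(|x|+√−t)²),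
and NOT plainly λ-DSS at some point of the past (∃ t<0, x: λu(λ²t,λx) ≠ u(t,x)), then the
CorkscrewProfile witness exists (same c, θ, R, u). Proof: slices are continuous hence
AEStronglyMeasurable and classically div-free hence weakly div-free; for s<t<0 the pair is classical
on [s,t] with u (Type-I: |u| ≤ C₀/√(−t)), p bounded, so the PROVED fact
Literature.Analysis.FluidPDE.IsClassicalNSSolutionOn.isMildNSSolutionOn_holds (classical + bounded ⇒
mild, Fabes–Jones–Rivière) applied to the time-translate gives IsMildNSSolutionBetween 1 0 u s t
(translation lemmas IsMildNSSolutionBetween.comp_add_right in SelfSimilar.lean); pointwise failure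
of plain DSS at (t,x) with both sides continuous gives failure on an open set, hence ¬(nsRescale c u
t =ᵐ u t); nontriviality the same way (if u t' =ᵐ 0 for al -/
@[route_item "route-NavierStokesRegularity-CorkscrewDynamo"]
def ClassicalCorkscrewSuffices : Prop :=
  (∃ (c θ C₀ : ℝ) (R : EuclideanSpace ℝ (Fin 3) ≃ₗᵢ[ℝ] EuclideanSpace ℝ (Fin 3)) (u : ℝ → EuclideanSpace ℝ (Fin 3) → EuclideanSpace ℝ (Fin 3)) (p : ℝ → EuclideanSpace ℝ (Fin 3) → ℝ), 1 < c ∧ (∀ x : EuclideanSpace ℝ (Fin 3), R x 0 = Real.cos θ * x 0 - Real.sin θ * x 1 ∧ R x 1 = Real.sin θ * x 0 + Real.cos θ * x 1 ∧ R x 2 = x 2) ∧ Literature.Analysis.FluidPDE.IsClassicalNSSolutionOn (Set.Iio 0) 1 0 u p ∧ Literature.Analysis.FluidPDE.IsRotatedDSS c R u ∧ Literature.Analysis.FluidPDE.HasTypeIDecay C₀ u ∧ (∀ t < 0, Literature.Analysis.FluidPDE.IsBoundedOn (Set.Iic t) p) ∧ (∃ t < 0, ∃ x, Literature.Analysis.FluidPDE.nsRescale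 c u t x ≠ u t x)) → ∃ (c θ : ℝ) (R : EuclideanSpace ℝ (Fin 3) ≃ₗᵢ[ℝ] EuclideanSpace ℝ (Fin 3)) (u : ℝ → EuclideanSpace ℝ (Fin 3) → EuclideanSpace ℝ (Fin 3)), 1 < c ∧ (∀ x : EuclideanSpace ℝ (Fin 3), R x 0 = Real.cos θ * x 0 - Real.sin θ * x 1 ∧ R x 1 = Real.sin θ * x 0 + Real.cos θ * x 1 ∧ R x 2 = x 2) ∧ Literature.Analysis.FluidPDE.IsAncientMildSolution 1 u ∧ (∀ t < 0, AEStronglyMeasurable (u t) volume) ∧ Literature.Analysis.FluidPDE.IsRotatedDSS c R u ∧ (∃ C₀ : ℝ, Literature.Analysis.FluidPDE.HasTypeIDecay C₀ u) ∧ ¬ (∀ t < 0, Literature.Analysis.FluidPDE.nsRescale c u t =ᵐ[volume] u t) ∧ ¬ (∀ t < 0, u t =ᵐ[volume] 0)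

-- `ClassicalCorkscrewSuffices` holds: proved by `Summit.NavierStokesRegularity.NavierStokesRegularity.Theorems.classicalCorkscrewSuffices_proof` @ 1dd295dec660 (its module imports this route file, so no `_holds` link can be stated here).

-- earlier WindDynamoExists (stmt-NavierStokesRegularity-1363, replaced 2026-08-15T10:58:11Z -> stmt-NavierStokesRegularity-1714): retired by None — ∃ (C : ℝ) (B : EuclideanSpace ℝ (Fin 3) → EuclideanSpace ℝ (Fin 3)), ContDiff ℝ ∞ B ∧ Literature.Analysis.FluidPDE.VectorCalculus.IsDivFree B ∧ (∀ y, (1 + ‖y‖) * ‖B y‖ + (1 + ‖y‖) ^ 2 * ‖fderiv ℝ B y‖ ≤ C) ∧ ∃ (Ω : ℝ → EuclideanSpace ℝ (Fin 3) → Euclidea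
-- earlier WindDynamoExists (stmt-NavierStokesRegularity-1714, replaced 2026-08-15T16:59:33Z -> stmt-NavierStokesRegularity-11287): retired by None — ∃ (C : ℝ) (B : EuclideanSpace ℝ (Fin 3) → EuclideanSpace ℝ (Fin 3)), ContDiff ℝ ∞ B ∧ Literature.Analysis.FluidPDE.VectorCalculus.IsDivFree B ∧ (∀ y, (1 + ‖y‖) * ‖B y‖ + (1 + ‖y‖) ^ 2 * ‖fderiv ℝ B y‖ ≤ C) ∧ ∃ (Ω : ℝ → EuclideanSpace ℝ (Fin 3) → Euclide
/-- item stmt-NavierStokesRegularity-11287 · support · rank 9 · open · by planner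
[support; the bare kinematic seed, implied by KinematicCorkscrewMode] THE KINEMATIC LIOUVILLE
PROBLEM IN LERAY'S WIND FAILS for some Type-I template: ∃ smooth steady div-free B with (1+|y|)|B| +
(1+|y|)²‖∇B‖ ≤ C and a smooth div-free ETERNAL solution Ω of ∂ₛΩ = curl((B+½y)×Ω) + ΔΩ on ℝ×ℝ³ in
the class (1+|y|)²|Ω(s,y)| ≤ K e^{μs} for all s (μ ≥ 0: at most exponential growth forward, hence
decay or boundedness in the past — the class of Floquet modes with multiplier ≥ 1, and of the
vorticity of any (R)DSS profile with μ = 0), with Ω(0,·) ≢ 0. Meaning for the summit: every Type-I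
(R)DSS Liouville proof must spend the self-consistency Ω = curl U (the induction-linearised
Liouville is false), and every construction can start from a kinematic mode. Sanity (B = 0): an
eternal solution in this class is ω(x,t) = (−t)^{-1}Ω solving the heat equation with |ω| ≤
K/(|x|²+(−t)), whose L² norm → 0 as t → −∞, hence ω ≡ 0 — dilution wins without stretching, so the
statement has content. Expected TRUE for large C by concentration/scaling of any genuine dynamo
flow; a clean proof is a real theorem (non-self-adjoint spectral perturbation with unbounded drift;
use L²_σ(e^{−|y|²/4}) where Δ − ½y·∇ − 1 h -/
@[route_item "route-NavierStokesRegularity-CorkscrewDynamo"]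
def WindDynamoExists : Prop :=
  ∃ (C : ℝ) (B : EuclideanSpace ℝ (Fin 3) → EuclideanSpace ℝ (Fin 3)), ContDiff ℝ (⊤ : ℕ∞) B ∧ Literature.Analysis.FluidPDE.VectorCalculus.IsDivFree B ∧ (∀ y, (1 + ‖y‖) * ‖B y‖ + (1 + ‖y‖) ^ 2 * ‖fderiv ℝ B y‖ ≤ C) ∧ ∃ (Ω : ℝ → EuclideanSpace ℝ (Fin 3) → EuclideanSpace ℝ (Fin 3)) (μ K : ℝ), 0 ≤ μ ∧ Literature.Analysis.FluidPDE.IsSmoothSpaceTimeOn Set.univ Ω ∧ (∀ s, Literature.Analysis.FluidPDE.VectorCalculus.IsDivFree (Ω s)) ∧ (∀ s y, Literature.Analysis.FluidPDE.timeDerivWithin Set.univ Ω s y = Literature.Analysis.FluidPDE.curl (fun z => Literature.Analysis.FluidPDE.cross (B z + (1 / 2 : ℝ) • z) (Ω s z)) y + Laplacian.laplacian (Ω s) y) ∧ (∀ s y, (1 + ‖y‖) ^ 2 * ‖Ω s y‖ ≤ K * Real.exp (μ * s)) ∧ Ω 0 ≠ 0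

-- earlier NoSmallConstantWindDynamo (stmt-NavierStokesRegularity-1364, replaced 2026-08-15T10:58:11Z -> stmt-NavierStokesRegularity-1715): retired by None — ∀ (a b : ℝ) (B : EuclideanSpace ℝ (Fin 3) → EuclideanSpace ℝ (Fin 3)), ContDiff ℝ ∞ B → Literature.Analysis.FluidPDE.VectorCalculus.IsDivFree B → (∀ y, ‖y‖ * ‖B y‖ ≤ a) → (∀ y, ‖fderiv ℝ B y‖ ≤ b) → b + a / 4 < 1 → ∀ (Ω : ℝ → EuclideanSpace ℝ (F
-- earlier NoSmallConstantWindDynamo (stmt-NavierStokesRegularity-1715, replaced 2026-08-15T16:59:33Z -> stmt-NavierStokesRegularity-11288): retired by None — ∀ (a b : ℝ) (B : EuclideanSpace ℝ (Fin 3) → EuclideanSpace ℝ (Fin 3)), ContDiff ℝ ∞ B → Literature.Analysis.FluidPDE.VectorCalculus.IsDivFree B → (∀ y, ‖y‖ * ‖B y‖ ≤ a) → (∀ y, ‖fderiv ℝ B y‖ ≤ b) → b + a / 4 < 1 → ∀ (Ω : ℝ → EuclideanSpace ℝ (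
/-- item stmt-NavierStokesRegularity-11288 · support · rank 9 · closed · proved by Summit.NavierStokesRegularity.NavierStokesRegularity.Theorems.noSmallConstantWindDynamo_proof (prover) · by planner
[support, POSITIVE side, explicit rung; provable now] SMALL-CONSTANT KINEMATIC ANTI-DYNAMO THEOREM
IN THE WIND: if B is smooth, steady, div-free with sup|y||B(y)| ≤ a and sup‖∇B‖_op ≤ b and b + a/4 <
1, then every smooth div-free eternal solution of ∂ₛΩ = curl((B+½y)×Ω) + ΔΩ with (1+|y|)²|Ω(s,y)| ≤
K e^{μs} (μ ≥ 0, all s) vanishes identically (Ω = 0 as a function on ℝ×ℝ³). Proof (two pages +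
parabolic bookkeeping): with γ = e^{−|y|²/4}, Δ − ½y·∇ is γ-symmetric (∫(Δf − ½y·∇f) g γ = −∫∇f·∇g
γ) and curl(½y×Ω) = −Ω − ½y·∇Ω, curl(B×Ω) = (Ω·∇)B − (B·∇)Ω, so ½ d/ds ∫|Ω|²γ = −∫|∇Ω|²γ − ∫|Ω|²γ +
∫⟨(Ω·∇)B, Ω⟩γ + ¼∫|Ω|²(B·y)γ ≤ −(1 − b − a/4)∫|Ω|²γ; hence ‖Ω(s)‖_γ ≤ e^{−κ(s−s₀)}‖Ω(s₀)‖_γ, κ = 1 −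
b − a/4 > 0, and ‖Ω(s₀)‖²_γ ≤ K²e^{2μs₀}∫(1+|y|)^{-4}γ → 0 as s₀ → −∞ for every fixed s.
Integrations by parts are justified by interior parabolic estimates (|∇Ω|, |∇²Ω| grow at most
polynomially in |y| on the class) against the Gaussian weight; the growth class (all s) is what
excludes Tychonoff-type non-uniqueness. Value: the first rung of the card's certificate ladder for
the LINEAR problem (any certified corkscrew template needs b + a/4 ≥ 1 in these units). [sources:
Backus1958, Davidson2001] [re -/
@[route_item "route-NavierStokesRegularity-CorkscrewDynamo"]
def NoSmallConstantWindDynamo : Prop :=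
  ∀ (a b : ℝ) (B : EuclideanSpace ℝ (Fin 3) → EuclideanSpace ℝ (Fin 3)), ContDiff ℝ (⊤ : ℕ∞) B → Literature.Analysis.FluidPDE.VectorCalculus.IsDivFree B → (∀ y, ‖y‖ * ‖B y‖ ≤ a) → (∀ y, ‖fderiv ℝ B y‖ ≤ b) → b + a / 4 < 1 → ∀ (Ω : ℝ → EuclideanSpace ℝ (Fin 3) → EuclideanSpace ℝ (Fin 3)) (μ K : ℝ), 0 ≤ μ → Literature.Analysis.FluidPDE.IsSmoothSpaceTimeOn Set.univ Ω → (∀ s, Literature.Analysis.FluidPDE.VectorCalculus.IsDivFree (Ω s)) → (∀ s y, Literature.Analysis.FluidPDE.timeDerivWithin Set.univ Ω s y = Literature.Analysis.FluidPDE.curl (fun z => Literature.Analysis.FluidPDE.cross (B z + (1 / 2 : ℝ) • z) (Ω s z)) y + Laplacian.laplacian (Ω s) y) → (∀ s y, (1 + ‖y‖) ^ 2 * ‖Ω s y‖ ≤ K * Real.exp (μ * s)) → Ω = 0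

-- `NoSmallConstantWindDynamo` holds: proved by `Summit.NavierStokesRegularity.NavierStokesRegularity.Theorems.noSmallConstantWindDynamo_proof` (its module imports this route file, so no `_holds` link can be stated here).

/-- item stmt-NavierStokesRegularity-1365 · support · rank 9 · closed · proved by Summit.NavierStokesRegularity.NavierStokesRegularity.Theorems.sphereTangentLiouville_proof @ d24252b207a9 (prover) · by planner
[support, POSITIVE side; the toroidal-velocity anti-dynamo theorem (Elsasser/Bullard–Gellman)
transplanted; provable now modulo in-tree regularity of bounded ancient mild solutions] A Type-I
rotated-λ-DSS ancient mild solution (any λ>1, any linear isometry R) that is everywhere tangent to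
the spheres about the origin (x·u(t,x) = 0 for all t<0, x) vanishes. Proof: in similarity variables
W = U + ½y, f := y·Ω satisfies the EXACT identity (∂ₛ + W·∇ − Δ + ½) f = Ω·∇(y·U) (check: ∂ₛΩ + W·∇Ω
= (Ω·∇)U − Ω + ΔΩ; W·∇(y·Ω) = W·Ω + y·(W·∇Ω); Δ(y·Ω) = y·ΔΩ + 2div Ω; Ω·∇(y·U) = Ω·U + y·((Ω·∇)U));
Type-I + scale-invariant regularity give |Ω| ≲ (1+|y|)^{-2}, so f → 0 at infinity, and sup_y|f(s,·)|
is periodic in s (RDSS; |f| is rotation/reflection invariant up to sign); if y·U ≡ 0 the +½ damping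
and the maximum principle force sup|f| ≤ e^{−(s−s₀)/2} sup|f(s₀)| ⇒ f ≡ 0; then on every sphere |y|
= r the field U is tangent, surface-divergence-free (div U = 0, U_r = 0) and surface-curl-free
((y/|y|)·curl U = 0), i.e. a harmonic 1-form on S² ⇒ U ≡ 0. Consequence for the template: a
corkscrew must carry radial (poloidal) velocity — pure swirling 'onion' profiles are excluded, the
profile analogue of 't -/
@[route_item "route-NavierStokesRegularity-CorkscrewDynamo"]
def SphereTangentLiouville : Prop :=
  ∀ (c : ℝ) (R : EuclideanSpace ℝ (Fin 3) ≃ₗᵢ[ℝ] EuclideanSpace ℝ (Fin 3)) (u : ℝ → EuclideanSpace ℝ (Fin 3) → EuclideanSpace ℝ (Fin 3)), 1 < c → Literature.Analysis.FluidPDE.IsAncientMildSolution 1 u → (∀ t < 0, AEStronglyMeasurable (u t) volume) → Literature.Analysis.FluidPDE.IsRotatedDSS c R u → (∃ C₀ : ℝ, Literature.Analysis.FluidPDE.HasTypeIDecay C₀ u) → (∀ t < 0, ∀ x, ⟪x, u t x⟫_ℝ = 0) → ∀ t < 0, u t =ᵐ[volume] 0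

-- `SphereTangentLiouville` holds: proved by `Summit.NavierStokesRegularity.NavierStokesRegularity.Theorems.sphereTangentLiouville_proof` @ d24252b207a9 (its module imports this route file, so no `_holds` link can be stated here).

-- earlier Assembly (stmt-NavierStokesRegularity-1360, replaced 2026-08-15T16:59:33Z -> stmt-NavierStokesRegularity-11286): retired by None — (∃ (c θ : ℝ) (u : ℝ → EuclideanSpace ℝ (Fin 3) → EuclideanSpace ℝ (Fin 3)), 1 < c ∧ Literature.Analysis.FluidPDE.IsAncientMildSolution 1 u ∧ (∀ t < 0, AEStronglyMeasurable (u t) volume) ∧ Literature.Analysis.FluidPDE.IsRotatedDSS c (Literature.Analysis.FluidPDE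
/-- item stmt-NavierStokesRegularity-11286 · assembly · rank 1 · closed · proved by Summit.NavierStokesRegularity.NavierStokesRegularity.Theorems.corkscrewDynamo_assembly_proof (prover) · by planner
sources: Fefferman2000, BealeKatoMajda1984
[assembly] CorkscrewProfile → RdssProfileTruncation → ClayUniqueness (X5b, stmt-0153) →
¬NavierStokesRegularity, stated BY NAME over the route's own decls (rev-4; the rev-1 text inlined
the three bodies — read by the glue lint as extra hypotheses — and named the wall
TypeIDSSLiouvilleConjecture, dragging SelfSimilarLiouville.lean into the cone). It is literally the
type of the deciding theorem `closes` (D-0027 §2.1) rendered at the end of this file, so a prover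
lands it in one line (`theorem assembly_holds : Assembly := closes`; checked in the planner's
Sketch.lean). Content: the corkscrew is a nontrivial Type-I RDSS profile; the conjecture-free
rotated truncation bridge gives a rapidly decaying datum with a finite-lifespan Leray–Hopf classical
solution (X5a); Clay (A) on that datum + ClayUniqueness extend it past its lifespan, contradicting
maximality — Literature.NS.blowup_assembly inlined. -/
@[route_item "route-NavierStokesRegularity-CorkscrewDynamo"]
def Assembly : Prop :=
  CorkscrewProfile → RdssProfileTruncation → ClayUniqueness → ¬ _root_.NavierStokesRegularity

-- `Assembly` holds: proved by `Summit.NavierStokesRegularity.NavierStokesRegularity.Theorems.corkscrewDynamo_assembly_proof` (its module imports this route file, so no `_holds` link can be stated here).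

-- records of items no longer active in this route (dropped / restated):
-- earlier DssTruncationBridge (stmt-NavierStokesRegularity-0901, replaced 2026-08-15T16:25:57Z -> stmt-NavierStokesRegularity-10856): retired by None — ¬ Literature.Analysis.FluidPDE.TypeIDSSLiouvilleConjecture → ∃ ν : ℝ, 0 < ν ∧ ∃ T : ℝ, 0 < T ∧ ∃ (u : ℝ → EuclideanSpace ℝ (Fin 3) → EuclideanSpace ℝ (Fin 3)) (p : ℝ → EuclideanSpace ℝ (Fin 3) → ℝ), Literature.Analysis.FluidPDE.IsMaximalSmoothSolutio

/-! D-0027 §2.1 — DECIDING THEOREM (planner-authored via `route open/edit --closes-file`; by planner-rbadge-NavierStokesRegularity-Corkscre-c6e82750-g2-0 2026-08-15T16:59:33Z):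
its hypotheses are this route's items and its conclusion the sub-problem Statement (glue_lint), and it elaborates with this file. -/

/-- DECIDING THEOREM (D-0027 §2.1), NEGATIVE side: the route refutes Clay (A). The corkscrew
`(c, θ, R, u)` of `CorkscrewProfile` is in particular a NONTRIVIAL Type-I rotated-λ-DSS ancient mild
solution; the conjecture-free rotated truncation bridge `RdssProfileTruncation` turns it into a
rapidly decaying datum whose Leray–Hopf classical solution has FINITE maximal lifespan `T` (X5a);
Clay (A) applied to that datum gives a global smooth bounded-energy solution, `ClayUniqueness`
(X5b, stmt-0153) glues it to the blowing-up one on `[0, T)`, and its restriction to `[0, T+1)` is a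
smooth extension past `T` — contradicting maximality (the argument of the accepted
`Literature.NS.blowup_assembly`, inlined together with the wave-0 bridge
`isNavierStokesSolution_and_smooth_iff` so that the route file imports neither `NSLerayHopf` nor
`Theorems.BlowupAssembly`; pure logic, axioms propext / Classical.choice / Quot.sound). -/
@[closes "route-NavierStokesRegularity-CorkscrewDynamo"] theorem closes (hP : CorkscrewProfile) (hT : RdssProfileTruncation) (hU : ClayUniqueness) :
    ¬ _root_.NavierStokesRegularity := by
  obtain ⟨c, θ, R, u, hc, -, hmild, hmeas, hrdss, hC, -, hnz⟩ := hP
  obtain ⟨ν, hν, T, hT, v, q, ⟨hcl, hmax⟩, hLH, hdec⟩ := hT ⟨c, R, u, hc, hmild, hmeas, hrdss, hC, hnz⟩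
  intro hA
  have h0 : (0 : ℝ) ∈ Set.Ico 0 T := ⟨le_rfl, hT⟩
  obtain ⟨u', p', hu', hp', hns, hbe⟩ :=
    hA ν hν (v 0) (hcl.contDiff_velocity h0) (hcl.divFree 0 h0) hdec
  have heq : ∀ t ∈ Set.Ico 0 T, u' t = v t :=
    hU ν hν (v 0) hdec u' v p' q T hT hu' hp' hns hbe hcl hLH rfl
  have hcl' : Literature.Analysis.FluidPDE.IsClassicalNSSolutionOn (Set.Ici 0) ν 0 u' p' :=
    ⟨hu', hp', fun t ht x => hns.momentum t ht x, fun t ht => hns.divFree t ht⟩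
  refine hmax ⟨T + 1, by linarith, u', p', ?_, heq⟩
  exact hcl'.mono (fun t ht => ht.1) (uniqueDiffOn_Ico 0 (T + 1))

end Summit.NavierStokesRegularity.NavierStokesRegularity.Theses.CorkscrewDynamo
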